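import Mathlib.Algebra.MvPolynomial.CommRing
import Summits.CriticalPhenomena.PercolationContinuityZ3.Theorems.PercNearOneGluingNoHeavyLowerTailSahiCTCWeightedLYM
import HarnessLib

/-!
# `NoHeavyLowerTail` (crux stmt-CriticalPhenomena-4575), P3 lane: the GENERATING-FUNCTION CALCULUS of the c = 2 certificate programme —
# set families as multivariate polynomials, the coefficient of a product as a count of profile pairs, and the weighted LYM / flag lemmas
# as COEFFICIENTWISE polynomial inequalities

Support file (seat `prim-l12-p3`, gen 18; `--supports stmt-CriticalPhenomena-4575`).  Memos
`run/shared/lean/prim/prim-l12/FROM-prim-l12-p3-g17-REDUCTION-TO-3-COLOURINGS.md` §1 and `…-g18-VALUE-LEVEL-REDUCTION.md` §6.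

The programme (memos g9–g18 of the lane) manipulates generating functions `GF(F) = Σ_{S ∈ F} r^S ∈ ℤ[r_i : i ∈ α]` of set families
`F ⊆ 2^α` and proves inequalities COEFFICIENTWISE (`P ∈ ℕ[r]`).  This file sets up that calculus on top of Mathlib's `MvPolynomial`:

* `ind S : α →₀ ℕ` — the exponent vector `1_S` of a finset (`ind_apply`, `ind_injective`); `gf F := Σ_{S ∈ F} X^{1_S}` (`gf`);
* `coeff_gf` — the coefficient of `r^n` in `GF(F)` is the number of `S ∈ F` with `1_S = n` (so `0` or `1`);
* `coeff_gf_mul_gf` — the coefficient of `r^n` in `GF(F)·GF(G)` is the number of pairs `(P, S) ∈ F × G` with `1_P + 1_S = n`;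
  `coeff_gf_mul` — peeling one family off an arbitrary product (`Σ_{S ∈ F, 1_S ≤ n} coeff_{n − 1_S} P`);
* `ind_add_ind_eq_iff` — `1_P + 1_S = n` iff `n ≤ 2` pointwise, `P ∩ S = {n = 2}` and `P ∪ S = supp n`: the bridge to the profile pairs
  `SahiCTCWeightedLYM.pairs` of the companion file (`card_filter_eq_card_pairs`);
* `coeff_weightedLYM` — for an up-set `𝒰` of a finite type and `c ≤ j`, every coefficient of `e_j·GF(𝒰_c)` is at most the corresponding
  coefficient of `e_c·GF(𝒰_j)` (`e_k = GF(all k-sets)`, `𝒰_k` = level `k` of `𝒰`), i.e. `e_c·𝒰_j − e_j·𝒰_c ∈ ℕ[r]` — memo g17 Lemma 1.1 / the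
  (o) row of the threshold certificate, as a polynomial statement;
* `coeff_flagLemma` — `Θ·t̄ − D·ε̄ ∈ ℕ[r]` (memo g17 Lemma 1.2 = M2) in the same form (`Θ` = sets of size ≤ 2, `D` = size ≥ 3, `ε̄ = 𝒰_2`, `t̄ = 𝒰_{≥3}`);
  `coeff_mul_nonneg` and the `_sub_nonneg` forms (differences with nonnegative coefficients).

Not here: the closed forms `G022`, `Ñ_2`, … and the identities (M1), (M2) of the reduction theorem (they need the dictionary of a pair of complexes).
Nothing is asserted about the crux.
-/

namespace Summit.CriticalPhenomena.PercolationContinuityZ3.Theorems.SahiCTCGenFun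

open Finset MvPolynomial SahiCTCWeightedLYM

variable {α : Type*} [DecidableEq α]

/-! ### Exponent vectors of finsets and generating functions of set families -/

/-- The exponent vector `1_S : α →₀ ℕ` of a finset `S` (value `1` on `S`, `0` elsewhere). [this work] -/
noncomputable def ind (S : Finset α) : α →₀ ℕ := ∑ i ∈ S, Finsupp.single i 1

omit [DecidableEq α] in
/-- `1_S(i) = [i ∈ S]`. [this work] -/
theorem ind_apply [DecidableEq α] (S : Finset α) (i : α) : ind S i = if i ∈ S then 1 else 0 := by
  unfold ind
  rw [Finsupp.finsetSum_apply]
  simp_rw [Finsupp.single_apply]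
  rw [Finset.sum_ite_eq']

omit [DecidableEq α] in
/-- `S ↦ 1_S` is injective. [this work] -/
theorem ind_injective [DecidableEq α] : Function.Injective (ind : Finset α → α →₀ ℕ) := by
  intro S T h
  ext i
  have hi := congrArg (fun f => f i) h
  simp only [ind_apply] at hi
  by_cases hS : i ∈ S <;> by_cases hT : i ∈ T <;> simp_all

/-- The generating function `GF(F) = Σ_{S ∈ F} r^{1_S}` of a set family, as an integer multivariate polynomial. [this work] -/
noncomputable def gf (F : Finset (Finset α)) : MvPolynomial α ℤ := ∑ S ∈ F, monomial (ind S) 1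

/-- The coefficient of `r^n` in `GF(F)` counts the members `S ∈ F` with `1_S = n` (hence is `0` or `1`). [this work] -/
theorem coeff_gf (F : Finset (Finset α)) (n : α →₀ ℕ) :
    (gf F).coeff n = #(F.filter fun S => ind S = n) := by
  unfold gf
  rw [coeff_sum]
  simp_rw [coeff_monomial]
  rw [Finset.sum_boole]

/-- **Coefficient of a product of two generating functions** = number of pairs `(P, S) ∈ F × G` with `1_P + 1_S = n`. [this work] -/
theorem coeff_gf_mul_gf (F G : Finset (Finset α)) (n : α →₀ ℕ) :
    (gf F * gf G).coeff n = #((F ×ˢ G).filter fun PS => ind PS.1 + ind PS.2 = n) := by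
  rw [coeff_mul]
  simp_rw [coeff_gf]
  -- count the pairs fibrewise over the antidiagonal of `n`
  rw [card_eq_sum_card_fiberwise (f := fun PS : Finset α × Finset α => (ind PS.1, ind PS.2)) (t := antidiagonal n)
    (fun PS hPS => by
      have h := (mem_filter.1 (Finset.mem_coe.1 hPS)).2
      simpa [mem_antidiagonal] using h)]
  push_cast
  refine sum_congr rfl fun x hx => ?_
  rw [mem_antidiagonal] at hx
  have hfib : ((F ×ˢ G).filter fun PS => ind PS.1 + ind PS.2 = n).filter
      (fun PS => (ind PS.1, ind PS.2) = x) = (F.filter fun S => ind S = x.1) ×ˢ (G.filter fun S => ind S = x.2) := by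
    ext PS
    simp only [mem_filter, mem_product, Prod.ext_iff]
    constructor
    · rintro ⟨⟨⟨hP, hS⟩, _⟩, h1, h2⟩
      exact ⟨⟨hP, h1⟩, hS, h2⟩
    · rintro ⟨⟨hP, h1⟩, hS, h2⟩
      refine ⟨⟨⟨hP, hS⟩, ?_⟩, h1, h2⟩
      rw [h1, h2, hx]
  rw [hfib, card_product]
  push_cast
  rfl

omit [DecidableEq α] in
/-- **Coefficient of `GF(F)·P` for any polynomial `P`** (peel one family off a product of several): the sum over the members `S ∈ F`
fitting under the profile `n` of the coefficient of `P` at the residual profile `n − 1_S`.  Iterating gives the tuple counts behind the 3- and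
4-factor forms of the programme. [this work] -/
theorem coeff_gf_mul (F : Finset (Finset α)) (P : MvPolynomial α ℤ) (n : α →₀ ℕ) :
    (gf F * P).coeff n = ∑ S ∈ F.filter (fun S => ind S ≤ n), P.coeff (n - ind S) := by
  unfold gf
  rw [Finset.sum_mul, coeff_sum, Finset.sum_filter]
  refine sum_congr rfl fun S _ => ?_
  rw [coeff_monomial_mul', one_mul]

/-- A generating function has nonnegative coefficients. [this work] -/
theorem coeff_gf_nonneg (F : Finset (Finset α)) (n : α →₀ ℕ) : 0 ≤ (gf F).coeff n := by
  rw [coeff_gf]; exact Int.natCast_nonneg _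

/-- Products preserve coefficientwise nonnegativity (the closure property behind every 'manifestly nonnegative' bracket of the programme). [folklore] -/
theorem coeff_mul_nonneg {P Q : MvPolynomial α ℤ} (hP : ∀ m, 0 ≤ P.coeff m) (hQ : ∀ m, 0 ≤ Q.coeff m) (n : α →₀ ℕ) :
    0 ≤ (P * Q).coeff n := by
  rw [coeff_mul]
  exact Finset.sum_nonneg fun x _ => mul_nonneg (hP _) (hQ _)

/-! ### The bridge `1_P + 1_S = n` ↔ (intersection, union) = (doubled points, support) -/

/-- The doubled points of a profile `n`: `{i : n i = 2}` (inside the support). [this work] -/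
def dbl (n : α →₀ ℕ) : Finset α := n.support.filter fun i => n i = 2

/-- `1_P + 1_S = n` iff `n ≤ 2` pointwise, `P ∩ S` is the set of doubled points of `n` and `P ∪ S` is its support. [this work] -/
theorem ind_add_ind_eq_iff (P S : Finset α) (n : α →₀ ℕ) :
    ind P + ind S = n ↔ (∀ i, n i ≤ 2) ∧ P ∩ S = dbl n ∧ P ∪ S = n.support := by
  constructor
  · intro h
    have hi : ∀ i, n i = (if i ∈ P then 1 else 0) + (if i ∈ S then 1 else 0) := fun i => by
      rw [← h, Finsupp.add_apply, ind_apply, ind_apply]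
    refine ⟨fun i => ?_, ?_, ?_⟩
    · rw [hi i]; split_ifs <;> omega
    · ext i
      simp only [mem_inter, dbl, mem_filter, Finsupp.mem_support_iff, hi i]
      by_cases hP : i ∈ P <;> by_cases hS : i ∈ S <;> simp [hP, hS]
    · ext i
      simp only [mem_union, Finsupp.mem_support_iff, hi i]
      by_cases hP : i ∈ P <;> by_cases hS : i ∈ S <;> simp [hP, hS]
  · rintro ⟨hle, hI, hU⟩
    ext i
    rw [Finsupp.add_apply, ind_apply, ind_apply]
    have h2 : (i ∈ P ∧ i ∈ S) ↔ n i = 2 := by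
      rw [← mem_inter, hI, dbl, mem_filter, Finsupp.mem_support_iff]
      constructor
      · rintro ⟨_, h⟩; exact h
      · intro h; exact ⟨by omega, h⟩
    have h1 : (i ∈ P ∨ i ∈ S) ↔ n i ≠ 0 := by rw [← mem_union, hU, Finsupp.mem_support_iff]
    have h3 := hle i
    by_cases hP : i ∈ P <;> by_cases hS : i ∈ S <;> simp only [hP, hS, if_true, if_false, and_true, and_false,
      or_true, or_false, true_iff, false_iff] at h1 h2 ⊢ <;> omega

/-- For the families `{P ⊆ univ : pP #P}` and `{S ∈ 𝒰 : pS #S}` the product-coefficient count at a profile `n ≤ 2` is the profile-pair count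
`SahiCTCWeightedLYM.pairs 𝒰 (dbl n) (supp n) pP pS` of the companion file. [this work] -/
theorem filter_prod_eq_pairs [Fintype α] (𝒰 : Finset (Finset α)) (pP pS : ℕ → Prop) [DecidablePred pP] [DecidablePred pS]
    (n : α →₀ ℕ) (hn : ∀ i, n i ≤ 2) :
    ((univ.powerset.filter fun P => pP #P) ×ˢ (𝒰.filter fun S => pS #S)).filter (fun PS => ind PS.1 + ind PS.2 = n) =
      pairs 𝒰 (dbl n) n.support pP pS := by
  ext PS
  rw [mem_pairs, mem_filter, mem_product, mem_filter, mem_filter, ind_add_ind_eq_iff]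
  constructor
  · rintro ⟨⟨⟨_, hP⟩, hS, hS'⟩, _, hI, hU⟩
    exact ⟨hS, hI, hU, hP, hS'⟩
  · rintro ⟨hS, hI, hU, hP, hS'⟩
    exact ⟨⟨⟨mem_powerset.2 (subset_univ _), hP⟩, hS, hS'⟩, hn, hI, hU⟩

/-- If some `n i ≥ 3` then no pair of finsets has `1_P + 1_S = n`: the product-coefficient count vanishes. [this work] -/
theorem filter_prod_eq_empty (F G : Finset (Finset α)) (n : α →₀ ℕ) (hn : ¬ ∀ i, n i ≤ 2) :
    ((F ×ˢ G).filter fun PS => ind PS.1 + ind PS.2 = n) = ∅ := by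
  refine filter_eq_empty_iff.2 fun PS _ h => hn ?_
  exact ((ind_add_ind_eq_iff _ _ _).1 h).1

/-! ### Weighted LYM and the flag lemma as coefficientwise polynomial inequalities -/

/-- **Weighted LYM, polynomial form** (memo g17 Lemma 1.1; the (o) row of the c = 2 threshold certificate): for an up-set `𝒰` of the finite
cube `2^α` and `c ≤ j`, every coefficient of `e_j · GF(𝒰_c)` is at most the corresponding coefficient of `e_c · GF(𝒰_j)`, where `e_k` is the
generating function of all `k`-subsets and `𝒰_k` the level `k` of `𝒰`; i.e. `e_c·GF(𝒰_j) − e_j·GF(𝒰_c)` has nonnegative coefficients. [this work] -/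
theorem coeff_weightedLYM [Fintype α] {𝒰 : Finset (Finset α)} (h𝒰 : IsUpperSet (𝒰 : Set (Finset α))) {c j : ℕ} (hcj : c ≤ j)
    (n : α →₀ ℕ) :
    (gf (univ.powerset.filter fun P => #P = j) * gf (𝒰.filter fun S => #S = c)).coeff n ≤
      (gf (univ.powerset.filter fun P => #P = c) * gf (𝒰.filter fun S => #S = j)).coeff n := by
  rw [coeff_gf_mul_gf, coeff_gf_mul_gf]
  by_cases hn : ∀ i, n i ≤ 2
  · rw [filter_prod_eq_pairs 𝒰 (· = j) (· = c) n hn, filter_prod_eq_pairs 𝒰 (· = c) (· = j) n hn]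
    exact_mod_cast weightedLYM_pairs_of_isUpperSet h𝒰 (dbl n) n.support hcj
  · rw [filter_prod_eq_empty _ _ n hn, filter_prod_eq_empty _ _ n hn]

/-- **The flag lemma, polynomial form** (memo g17 Lemma 1.2 = M2): for an up-set `𝒰` of the finite cube (e.g. the non-faces of a simplicial complex),
every coefficient of `D · GF(𝒰_2)` is at most the corresponding coefficient of `Θ · GF(𝒰_{≥3})`, where `D` = all sets of size `≥ 3` and `Θ` = all sets
of size `≤ 2`; i.e. `Θ·t̄ − D·ε̄ ∈ ℕ[r]`. [this work] -/
theorem coeff_flagLemma [Fintype α] {𝒰 : Finset (Finset α)} (h𝒰 : IsUpperSet (𝒰 : Set (Finset α))) (n : α →₀ ℕ) :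
    (gf (univ.powerset.filter fun P => 3 ≤ #P) * gf (𝒰.filter fun S => #S = 2)).coeff n ≤
      (gf (univ.powerset.filter fun P => #P ≤ 2) * gf (𝒰.filter fun S => 3 ≤ #S)).coeff n := by
  rw [coeff_gf_mul_gf, coeff_gf_mul_gf]
  by_cases hn : ∀ i, n i ≤ 2
  · rw [filter_prod_eq_pairs 𝒰 (3 ≤ ·) (· = 2) n hn, filter_prod_eq_pairs 𝒰 (· ≤ 2) (3 ≤ ·) n hn]
    exact_mod_cast flagLemma_pairs_of_isUpperSet h𝒰 (dbl n) n.support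
  · rw [filter_prod_eq_empty _ _ n hn, filter_prod_eq_empty _ _ n hn]

/-- Weighted LYM as `e_c·GF(𝒰_j) − e_j·GF(𝒰_c) ∈ ℕ[r]` (every coefficient of the difference is `≥ 0`). [this work] -/
theorem coeff_weightedLYM_sub_nonneg [Fintype α] {𝒰 : Finset (Finset α)} (h𝒰 : IsUpperSet (𝒰 : Set (Finset α))) {c j : ℕ}
    (hcj : c ≤ j) (n : α →₀ ℕ) :
    0 ≤ (gf (univ.powerset.filter fun P => #P = c) * gf (𝒰.filter fun S => #S = j) -
      gf (univ.powerset.filter fun P => #P = j) * gf (𝒰.filter fun S => #S = c)).coeff n := by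
  rw [coeff_sub, sub_nonneg]
  exact coeff_weightedLYM h𝒰 hcj n

/-- The flag lemma as `Θ·GF(𝒰_{≥3}) − D·GF(𝒰_2) ∈ ℕ[r]`. [this work] -/
theorem coeff_flagLemma_sub_nonneg [Fintype α] {𝒰 : Finset (Finset α)} (h𝒰 : IsUpperSet (𝒰 : Set (Finset α))) (n : α →₀ ℕ) :
    0 ≤ (gf (univ.powerset.filter fun P => #P ≤ 2) * gf (𝒰.filter fun S => 3 ≤ #S) -
      gf (univ.powerset.filter fun P => 3 ≤ #P) * gf (𝒰.filter fun S => #S = 2)).coeff n := by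
  rw [coeff_sub, sub_nonneg]
  exact coeff_flagLemma h𝒰 n

end Summit.CriticalPhenomena.PercolationContinuityZ3.Theorems.SahiCTCGenFun
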